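import Literature.Barriers.Parity.SiegelZeroPrimePairsMainTermCutoff
import Literature.NumberTheory.Sieve.DyadicPartitionOfUnity
import HarnessLib

/-!
# Matomäki–Merikoski §7, main term of `Σ̃_{L,L}`: the `L`-type dyadic cutoff `∑_{M > X^{1/2}} F(y/(Mn))`

Sibling of `SiegelZeroPrimePairsMainTermDyadic.lean` (the `S`-type cutoff `∑_{M ≤ X^{1/2}} F(m/M)`).  Everything
here is PROVED (theorems only).  In the evaluation of `Σ̃_{L,L}` (arXiv:2112.11412, p. 21) the `n₁`-sum
carries, for FIXED `y`, the weight `∑_{M₁ = 2^i, X^{1/2} < M₁ ≤ 4X} F(y/(M₁ n₁))`; the source treats it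
"similarly to the case of `Σ_{S,S}`" by "partial summation, Lemma 2.4 (with `y = 1`)".  We make this precise:

* `MatomakiMerikoski.sum_dyadicBump_cutoffL_eq` — for `y > 0`, `n ≥ 1`, `b + 1 ≤ B` and `y ≤ 2^{B+1}`:
  `∑_{b+1 ≤ i ≤ B} F((y/n)/2^i) = Ψ((y/n)/2^{b+1})`; this is `1` for `n ≤ y/2^{b+2}`, `0` for `n ≥ y/2^{b+1}`,
  and antitone in `n`;
* `MatomakiMerikoski.abs_sum_mul_dyadicCutoffL_sub_le` — if `|∑_{n ≤ N} g(n) − V| ≤ εV` for all integers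
  `⌊y/2^{b+2}⌋ ≤ N ≤ ⌈y/2^{b+1}⌉` (and `2^{b+2} ≤ y`), then for every `L ≥ ⌈y/2^{b+1}⌉`,
  `|∑_{1 ≤ n ≤ L} g(n) ∑_{b+1 ≤ i ≤ B} F((y/n)/2^i) − V| ≤ εV` (from `abs_sum_mul_cutoff_sub_le`).

## References

* K. Matomäki, J. Merikoski, IMRN 2023:23, 20337–20384 (arXiv:2112.11412), §7, evaluation of `Σ̃_{L,L}`
  (p. 21: "Similarly to the case of `Σ_{S,S}`, we can use partial summation, Lemma 2.4 (with `y = 1`)").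
  [cite: MatomakiMerikoski2023, §7 (main term of Σ_{L,L})]
-/

noncomputable section

open Finset

namespace Literature.Barriers.Parity.MatomakiMerikoski

open Literature.NumberTheory.Sieve

/-- **The `L`-type dyadic cutoff in closed form.**  For `y > 0`, a natural `n ≥ 1`, and `b + 1 ≤ B` with
`y ≤ 2^{B+1}`: `∑_{b+1 ≤ i ≤ B} F((y/n)/2^i) = Ψ((y/n)/2^{b+1})`.
[cite: MatomakiMerikoski2023, §7 (main term of Σ_{L,L})] -/
theorem sum_dyadicBump_cutoffL_eq {y : ℝ} (hy : 0 < y) {b B : ℕ} (hbB : b + 1 ≤ B)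
    (hB : y ≤ (2 : ℝ) ^ (B + 1)) {n : ℕ} (hn : 1 ≤ n) :
    ∑ i ∈ Finset.Icc ((b : ℤ) + 1) B, dyadicBump ((y / n) / (2 : ℝ) ^ i) =
      smoothStep ((y / n) / (2 : ℝ) ^ (((b : ℤ) + 1))) := by
  have hab : (b : ℤ) + 1 ≤ (B : ℤ) := by exact_mod_cast hbB
  rw [sum_Icc_dyadicBump hab]
  have hn1 : (1 : ℝ) ≤ n := by exact_mod_cast hn
  have hn0 : (0 : ℝ) < n := by linarith
  have htop : smoothStep ((y / n) / (2 : ℝ) ^ ((B : ℤ) + 1)) = 0 := by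
    refine smoothStep_of_le_one ?_
    have h2 : (0 : ℝ) < (2 : ℝ) ^ ((B : ℤ) + 1) := zpow_pos two_pos _
    rw [div_le_one h2, div_le_iff₀ hn0]
    have e : (2 : ℝ) ^ ((B : ℤ) + 1) = (2 : ℝ) ^ (B + 1) := by
      rw [show ((B : ℤ) + 1) = ((B + 1 : ℕ) : ℤ) by push_cast; ring, zpow_natCast]
    rw [e]
    nlinarith [pow_pos (two_pos (α := ℝ)) (B + 1)]
  rw [htop, sub_zero]

/-- Properties of the closed form `w(n) = Ψ((y/n)/2^{b+1})` (`n ≥ 1`; value `1` at `n = 0` by convention):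
`w(n) = 1` for `n ≤ ⌊y/2^{b+2}⌋`, `w(n) = 0` for `n > ⌈y/2^{b+1}⌉`, and `w` is antitone on `n ≥ 1`. [folklore] -/
theorem smoothStep_cutoffL_props {y : ℝ} (hy : 0 < y) (b : ℕ) :
    let w : ℕ → ℝ := fun n => if n = 0 then 1 else smoothStep ((y / n) / (2 : ℝ) ^ (((b : ℤ) + 1)))
    (∀ n : ℕ, n ≤ ⌊y / (2 : ℝ) ^ (b + 2)⌋₊ → w n = 1) ∧
    (∀ n : ℕ, ⌈y / (2 : ℝ) ^ (b + 1)⌉₊ < n → w n = 0) ∧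
    (∀ n : ℕ, 1 ≤ n → w (n + 1) ≤ w n) := by
  intro w
  have h2b1 : (0 : ℝ) < (2 : ℝ) ^ (b + 1) := pow_pos two_pos _
  have h2b2 : (0 : ℝ) < (2 : ℝ) ^ (b + 2) := pow_pos two_pos _
  have ez : (2 : ℝ) ^ (((b : ℤ) + 1)) = (2 : ℝ) ^ (b + 1) := by
    rw [show ((b : ℤ) + 1) = ((b + 1 : ℕ) : ℤ) by push_cast; ring, zpow_natCast]
  refine ⟨fun n hn => ?_, fun n hn => ?_, fun n hn => ?_⟩
  · by_cases hn0 : n = 0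
    · simp [w, hn0]
    · have hn1 : 1 ≤ n := Nat.one_le_iff_ne_zero.mpr hn0
      have hnpos : (0 : ℝ) < n := by exact_mod_cast hn1
      simp only [w, hn0, if_false, ez]
      refine smoothStep_of_two_le ?_
      -- `n ≤ y/2^{b+2}` ⇒ `(y/n)/2^{b+1} ≥ 2`
      have hny : (n : ℝ) ≤ y / (2 : ℝ) ^ (b + 2) :=
        le_trans (by exact_mod_cast hn) (Nat.floor_le (by positivity))
      rw [le_div_iff₀ h2b2] at hny
      rw [le_div_iff₀ h2b1, le_div_iff₀ hnpos]
      calc 2 * (2 : ℝ) ^ (b + 1) * n = n * (2 : ℝ) ^ (b + 2) := by ring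
        _ ≤ y := hny
  · have hn0 : n ≠ 0 := by omega
    have hn1 : 1 ≤ n := Nat.one_le_iff_ne_zero.mpr hn0
    have hnpos : (0 : ℝ) < n := by exact_mod_cast hn1
    simp only [w, hn0, if_false, ez]
    refine smoothStep_of_le_one ?_
    have hny : y / (2 : ℝ) ^ (b + 1) ≤ n := le_trans (Nat.le_ceil _) (by exact_mod_cast hn.le)
    rw [div_le_iff₀ h2b1] at hny
    rw [div_le_one h2b1, div_le_iff₀ hnpos]
    linarith
  · have hn0 : n ≠ 0 := by omega
    have hn0' : n + 1 ≠ 0 := by omega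
    have hnpos : (0 : ℝ) < n := by exact_mod_cast hn
    simp only [w, hn0, hn0', if_false]
    refine smoothStep_monotone ?_
    have h2 : (0 : ℝ) < (2 : ℝ) ^ (((b : ℤ) + 1)) := zpow_pos two_pos _
    refine div_le_div_of_nonneg_right ?_ h2.le
    refine div_le_div_of_nonneg_left hy.le hnpos ?_
    push_cast; linarith

/-- **Partial summation against the `L`-type dyadic cutoff** (Matomäki–Merikoski §7, `Σ̃_{L,L}`): let
`y ≥ 2^{b+2}`, `b + 1 ≤ B`, `y ≤ 2^{B+1}`; if the partial sums of `g` satisfy `|∑_{1 ≤ n ≤ N} g(n) − V| ≤ εV` for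
all integers `⌊y/2^{b+2}⌋ ≤ N ≤ ⌈y/2^{b+1}⌉`, then for every `L ≥ ⌈y/2^{b+1}⌉`,
`|∑_{1 ≤ n ≤ L} g(n) ∑_{b+1 ≤ i ≤ B} F((y/n)/2^i) − V| ≤ εV`.
[cite: MatomakiMerikoski2023, §7 (main term of Σ_{L,L}, "partial summation, Lemma 2.4 (with y = 1)")] -/
theorem abs_sum_mul_dyadicCutoffL_sub_le {g : ℕ → ℝ} {V ε y : ℝ} {b B : ℕ} (hbB : b + 1 ≤ B)
    (hyb : (2 : ℝ) ^ (b + 2) ≤ y) (hB : y ≤ (2 : ℝ) ^ (B + 1)) {L : ℕ} (hL : ⌈y / (2 : ℝ) ^ (b + 1)⌉₊ ≤ L)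
    (hA : ∀ N : ℕ, ⌊y / (2 : ℝ) ^ (b + 2)⌋₊ ≤ N → N ≤ ⌈y / (2 : ℝ) ^ (b + 1)⌉₊ →
      |∑ n ∈ Icc 1 N, g n - V| ≤ ε * V) :
    |∑ n ∈ Icc 1 L, g n * ∑ i ∈ Finset.Icc ((b : ℤ) + 1) B, dyadicBump ((y / n) / (2 : ℝ) ^ i) - V| ≤
      ε * V := by
  have h2b2 : (0 : ℝ) < (2 : ℝ) ^ (b + 2) := pow_pos two_pos _
  have hy : 0 < y := lt_of_lt_of_le h2b2 hyb
  obtain ⟨hw1, hw0, hanti⟩ := smoothStep_cutoffL_props hy b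
  set w : ℕ → ℝ := fun n => if n = 0 then 1 else smoothStep ((y / n) / (2 : ℝ) ^ (((b : ℤ) + 1))) with hw
  set L₀ : ℕ := ⌊y / (2 : ℝ) ^ (b + 2)⌋₊ with hL₀
  set L₁ : ℕ := ⌈y / (2 : ℝ) ^ (b + 1)⌉₊ with hL₁
  -- `1 ≤ L₀ ≤ L₁`
  have hL0 : 1 ≤ L₀ := by
    rw [hL₀]
    refine Nat.le_floor ?_
    rw [Nat.cast_one, le_div_iff₀ h2b2]; linarith
  have hL01 : L₀ ≤ L₁ := by
    rw [hL₀, hL₁]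
    have : y / (2 : ℝ) ^ (b + 2) ≤ y / (2 : ℝ) ^ (b + 1) :=
      div_le_div_of_nonneg_left hy.le (pow_pos two_pos _)
        (pow_le_pow_right₀ (by norm_num) (by omega))
    exact_mod_cast (Nat.floor_le (by positivity)).trans (this.trans (Nat.le_ceil _))
  -- replace the dyadic sum by the closed form, and cut the range at `L₁`
  have hsub : Icc 1 L₁ ⊆ Icc 1 L := by
    intro n hn; rw [mem_Icc] at hn ⊢; omega
  have heq : ∑ n ∈ Icc 1 L, g n * ∑ i ∈ Finset.Icc ((b : ℤ) + 1) B, dyadicBump ((y / n) / (2 : ℝ) ^ i) =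
      ∑ n ∈ Icc 1 L₁, g n * w n := by
    rw [← sum_subset hsub]
    · refine sum_congr rfl fun n hn => ?_
      rw [mem_Icc] at hn
      have hn0 : n ≠ 0 := by omega
      rw [sum_dyadicBump_cutoffL_eq hy hbB hB hn.1]
      simp only [hw, hn0, if_false]
    · intro n hn hn'
      rw [mem_Icc] at hn hn'
      have hlt : L₁ < n := by omega
      have h0 := hw0 n hlt
      rw [sum_dyadicBump_cutoffL_eq hy hbB hB hn.1]
      have hn0 : n ≠ 0 := by omega
      simp only [hw, hn0, if_false] at h0
      rw [h0, mul_zero]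
  rw [heq]
  exact abs_sum_mul_cutoff_sub_le (a := g) (w := w) hL0 hL01 hw1 hw0 (fun n hn => hanti n (hL0.trans hn)) hA

end Literature.Barriers.Parity.MatomakiMerikoski
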